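import Summits.Ventures.CertifiedManyBodySolver.Downfold.EmeryOrbitalWeightShell
import HarnessLib

/-!
# Beyond the saddle: the Cu-d weight at the Γ–X AXIS point of a contour in closed form, `w_axis(ε) = t_pd²(Δ + ε)/(t_pd²(Δ + 2ε) − t_pp′ε²)`, a UNIVERSAL upper end
# `w_d(k) ≤ w_axis(ε)` for every zone point of every contour, its lever, and a shell theorem that needs no face window

Venture CertifiedManyBodySolver, cell `pub/hubbard-downfold` (stage S1; INFLATION-RULES-3to1-B §B.73 (g)), seat hubbard-downfold-mod-4 (technique B, g29); namespace
`Summit.Ventures.CertifiedManyBodySolver.Downfold.Emery`. Sequel of `EmeryOrbitalWeightNode` (node), `EmeryOrbitalWeightFace`/`…FaceLever` (antinode = zone-face point, hole-like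
surfaces), `EmeryOrbitalWeightMonotone` (`dWeight_lt_of_sum_lt`: the weight increases with `s = x + y` along a contour) and `EmeryOrbitalWeightShell`. Everything PROVED (0 sorry;
two-level algebra — the `p_y` orbital decouples on the axis `y = 0`). WHAT THIS IS NOT: a statement about any material; `U = 0` one-body kinematics of the σ model as printed.

* §1 THE AXIS POINT. On `y = sin²(k_y/2) = 0` the secular cubic factorises, `charCubic(x, 0; ε) = (Δ + ε)·(ε(Δ + 4t_pp′x + ε) − 4t_pd²x)` (`charCubic_axis_c`), so the contour meets
  the axis at `xAxis = ε(Δ + ε)/(4(t_pd² − t_pp′ε)) = cA/(4fsD)` (`charCubic_xAxis`, `xAxis_eq_div`; inside the zone iff `faceG ≤ 0`, i.e. the Fermi level is BELOW the `(π, 0)`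
  saddle — an ELECTRON-LIKE surface about Γ, `xAxis_le_one_iff`); there the Bloch state is the upper state of the two-level problem `d`–`p_x` and
  **`dWeightAxis(ε) = t_pd²(Δ + ε)/(t_pd²(Δ + 2ε) − t_pp′ε²)`** (`dWeightAxis_eq`); the energy denominator is positive (`dcharCubic_axis_pos`).
* §2 A UNIVERSAL UPPER END. Since `x + y ≤ cA/(4fsD) = xAxis` on EVERY zone contour (`sum_le_of_contour_face0`) and the weight increases with `s`:
  **`w_node(ε) ≤ w_d(x, y; ε) ≤ w_axis(ε)`** for every zone point of every contour in the regime (`dWeight_mem_Icc_node_axis`) — attained at the axis point when the surface is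
  electron-like, a strict bound (above `w_face`) when it is hole-like.
* §3 THE AXIS LEVER. `w_axis(ε₁) − w_axis(ε₂) ∝ (ε₂ − ε₁)·[t_pd²Δ − t_pp′(Δ(ε₁ + ε₂) + ε₁ε₂)]` (`dWeightAxis_sub`): **strictly decreasing in the Fermi energy iff
  `t_pp′(Δ(ε₁ + ε₂) + ε₁ε₂) < t_pd²Δ`** (`dWeightAxis_strictAnti`; unconditional at `t_pp′ = 0`, `dWeightAxis_strictAnti_pure`) — an honest two-sided criterion: for large `t_pp′ε²/Δ`
  the axis weight turns around (the `p_x` level `−Δ − 4t_pp′x` rises with `x`).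
* §4 THE SHELL THEOREM WITHOUT A FACE WINDOW (`dWeight_shell_axis`): regime, `0 < ε₁ ≤ ε₂`, `t_pp′ε₂ < t_pd²`, `t_pp′(2Δ + ε₂)ε₂ ≤ t_pd²Δ` ⇒ every zone Bloch state of every
  contour at `ε ∈ [ε₁, ε₂]` has `w_node(ε₂) ≤ w_d ≤ w_axis(ε₁)` — valid through and below the saddle (overdoped, electron-like surfaces), where `EmeryOrbitalWeightShell.dWeight_shell`
  (upper end `w_face(ε₁)`, sharper) needs the `ε₁`-surface hole-like.

Sources: three-band model [HybertsenSchluterChristensen1989, Eq. (1)]; [AndersenEtAl1995, §6]; [folklore] two-level algebra.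
-/

noncomputable section

namespace Summit.Ventures.CertifiedManyBodySolver.Downfold.Emery

open Real Set

/-! ## §1 The axis point and its weight in closed form -/

/-- The axis abscissa of the `ε`-contour: `xAxis = ε(Δ + ε)/(4(t_pd² − t_pp′ε))` (the contour meets `k_y = 0` at `sin²(k_x/2) = xAxis`; inside the zone iff `xAxis ≤ 1`).
[folklore] -/
def xAxis (Δ tpd c ε : ℝ) : ℝ := ε * (Δ + ε) / (4 * (tpd ^ 2 - c * ε))

/-- **The Cu-d weight of the AXIS Bloch state of the `ε`-contour** (a function of the energy alone). [folklore] -/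
def dWeightAxis (Δ tpd tpp c ε : ℝ) : ℝ := dWeight Δ tpd tpp c (xAxis Δ tpd c ε) 0 ε

/-- On the axis `y = 0` the secular cubic factorises (the `p_y` orbital decouples): `charCubic(x, 0; ε) = (Δ + ε)·(ε(Δ + 4t_pp′x + ε) − 4t_pd²x)`. [folklore] -/
theorem charCubic_axis_c (Δ tpd tpp c x ε : ℝ) : charCubic Δ tpd tpp c x 0 ε = (Δ + ε) * (ε * (Δ + 4 * c * x + ε) - 4 * tpd ^ 2 * x) := by
  unfold charCubic
  ring

/-- `xAxis = cA/(4fsD)` (the form of `sum_le_of_contour_face0`), for `Δ + ε ≠ 0`, `t_pd² ≠ t_pp′ε`. [folklore] -/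
theorem xAxis_eq_div {Δ tpd c ε : ℝ} (hE : Δ + ε ≠ 0) (hm : tpd ^ 2 - c * ε ≠ 0) : xAxis Δ tpd c ε = cA Δ ε / (4 * fsD Δ tpd c ε) := by
  unfold xAxis cA fsD
  rw [div_eq_div_iff (mul_ne_zero four_ne_zero hm) (mul_ne_zero four_ne_zero (mul_ne_zero hE hm))]
  ring

/-- `(xAxis, 0)` lies on the `ε`-contour (`t_pd² ≠ t_pp′ε`). [folklore] -/
theorem charCubic_xAxis {Δ tpd tpp c ε : ℝ} (hm : tpd ^ 2 - c * ε ≠ 0) : charCubic Δ tpd tpp c (xAxis Δ tpd c ε) 0 ε = 0 := by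
  have hx4 : 4 * (tpd ^ 2 - c * ε) * xAxis Δ tpd c ε = ε * (Δ + ε) := by unfold xAxis; field_simp
  rw [charCubic_axis_c]
  linear_combination (-(Δ + ε)) * hx4

/-- Uniqueness: an axis contour point `(x, 0)` with `Δ + ε ≠ 0`, `t_pd² ≠ t_pp′ε` IS `xAxis`. [folklore] -/
theorem eq_xAxis_of_axisPoint {Δ tpd tpp c x ε : ℝ} (hE : Δ + ε ≠ 0) (hm : tpd ^ 2 - c * ε ≠ 0) (hP : charCubic Δ tpd tpp c x 0 ε = 0) :
    x = xAxis Δ tpd c ε := by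
  rw [charCubic_axis_c] at hP
  have h := (mul_eq_zero.1 hP).resolve_left hE
  unfold xAxis
  rw [eq_div_iff (mul_ne_zero four_ne_zero hm)]
  linarith

/-- `xAxis > 0` for `ε > 0`, `Δ + ε > 0`, `t_pp′ε < t_pd²`. [folklore] -/
theorem xAxis_pos {Δ tpd c ε : ℝ} (hE : 0 < Δ + ε) (hε : 0 < ε) (hm : c * ε < tpd ^ 2) : 0 < xAxis Δ tpd c ε := by
  unfold xAxis
  have : 0 < tpd ^ 2 - c * ε := sub_pos.2 hm
  positivity

/-- `xAxis ≤ 1 ↔ faceG ≤ 0` (the axis point is inside the zone iff the Fermi level is at or below the `(π, 0)` saddle; `t_pp′ε < t_pd²`). [folklore] -/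
theorem xAxis_le_one_iff {Δ tpd c ε : ℝ} (hm : c * ε < tpd ^ 2) : xAxis Δ tpd c ε ≤ 1 ↔ faceG Δ tpd c ε ≤ 0 := by
  unfold xAxis faceG
  rw [div_le_one (by linarith)]
  constructor <;> intro h <;> linarith

/-- **CLOSED FORM OF THE AXIS WEIGHT**: `dWeightAxis(ε) = t_pd²(Δ + ε)/(t_pd²(Δ + 2ε) − t_pp′ε²)` (`Δ + ε > 0`, `ε > 0`, `t_pp′ε < t_pd²`; the two-level form `P/(P + ε)` with
`P = Δ + 4t_pp′xAxis + ε = (Δ + ε)t_pd²/(t_pd² − t_pp′ε)`). [folklore] -/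
theorem dWeightAxis_eq {Δ tpd tpp c ε : ℝ} (hE : 0 < Δ + ε) (hε : 0 < ε) (htpd : tpd ≠ 0) (hm : c * ε < tpd ^ 2) :
    dWeightAxis Δ tpd tpp c ε = tpd ^ 2 * (Δ + ε) / (tpd ^ 2 * (Δ + 2 * ε) - c * ε ^ 2) := by
  have hm' : 0 < tpd ^ 2 - c * ε := sub_pos.2 hm
  set x := xAxis Δ tpd c ε with hxdef
  have hx4 : 4 * (tpd ^ 2 - c * ε) * x = ε * (Δ + ε) := by
    rw [hxdef]; unfold xAxis; field_simp
  have hY : minorY Δ tpd c x ε = 0 := by unfold minorY; nlinarith [hx4]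
  have hD : minorD Δ tpp c x 0 ε = (Δ + 4 * c * x + ε) * (Δ + ε) := by unfold minorD; ring
  have hX : minorX Δ tpd c 0 ε = ε * (Δ + ε) := by unfold minorX; ring
  have ht : 0 < tpd ^ 2 := by positivity
  have e : (Δ + 4 * c * x + ε) * (tpd ^ 2 - c * ε) = (Δ + ε) * tpd ^ 2 := by linear_combination c * hx4
  have hP : 0 < Δ + 4 * c * x + ε := by
    have h1 : 0 < (tpd ^ 2 - c * ε) * (Δ + 4 * c * x + ε) := by rw [mul_comm, e]; positivity
    exact pos_of_mul_pos_right h1 hm'.le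
  unfold dWeightAxis dWeight
  rw [← hxdef, hD, hX, hY, add_zero]
  have hden : 0 < tpd ^ 2 * (Δ + 2 * ε) - c * ε ^ 2 := by nlinarith [mul_pos hε hm', mul_pos ht hE]
  rw [div_eq_div_iff (by positivity) hden.ne']
  linear_combination (ε * (Δ + ε)) * e

/-- On the axis the energy derivative is `∂_ε charCubic(x, 0; ε) = (Δ + ε)(Δ + 3ε) − 4x(t_pd² − t_pp′(Δ + 2ε))`. [folklore] -/
theorem dcharCubic_axis_eq (Δ tpd tpp c x ε : ℝ) :
    dcharCubic Δ tpd tpp c x 0 ε = (Δ + ε) * (Δ + 3 * ε) - 4 * x * (tpd ^ 2 - c * (Δ + 2 * ε)) := by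
  unfold dcharCubic dcA dfsD dfsN
  ring

/-- **THE AXIS ENERGY DENOMINATOR IS POSITIVE**: `0 < ∂_ε charCubic(xAxis, 0; ε)` (`Δ + ε > 0`, `ε > 0`, `0 ≤ t_pp′`, `t_pp′ε < t_pd²`): indeed
`(t_pd² − t_pp′ε)·∂_ε charCubic = (Δ + ε)[(t_pd² − t_pp′ε)(Δ + 2ε) + t_pp′ε(Δ + ε)]`. [folklore] -/
theorem dcharCubic_axis_pos {Δ tpd tpp c ε : ℝ} (hE : 0 < Δ + ε) (hε : 0 < ε) (hc : 0 ≤ c) (hm : c * ε < tpd ^ 2) :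
    0 < dcharCubic Δ tpd tpp c (xAxis Δ tpd c ε) 0 ε := by
  have hm' : 0 < tpd ^ 2 - c * ε := sub_pos.2 hm
  have hx4 : 4 * (tpd ^ 2 - c * ε) * xAxis Δ tpd c ε = ε * (Δ + ε) := by unfold xAxis; field_simp
  have key : (tpd ^ 2 - c * ε) * dcharCubic Δ tpd tpp c (xAxis Δ tpd c ε) 0 ε =
      (Δ + ε) * ((tpd ^ 2 - c * ε) * (Δ + 2 * ε) + c * ε * (Δ + ε)) := by
    rw [dcharCubic_axis_eq]
    linear_combination (-(tpd ^ 2 - c * (Δ + 2 * ε))) * hx4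
  have hpos : 0 < (Δ + ε) * ((tpd ^ 2 - c * ε) * (Δ + 2 * ε) + c * ε * (Δ + ε)) := by
    apply mul_pos hE
    have h1 : 0 < (tpd ^ 2 - c * ε) * (Δ + 2 * ε) := mul_pos hm' (by linarith)
    have h2 : 0 ≤ c * ε * (Δ + ε) := by positivity
    linarith
  rw [← key] at hpos
  exact pos_of_mul_pos_right hpos hm'.le

/-! ## §2 A universal upper end: every zone Fermi point lies between the node and the axis point -/

/-- **`w_node(ε) ≤ w_d(x, y; ε) ≤ w_axis(ε)` FOR EVERY ZONE POINT OF EVERY CONTOUR** in the regime (`Δ > 0`... precisely `Δ ≥ 0`, `0 ≤ t_pp′ ≤ t_pp`, `t_pp > 0`, `t_pd ≠ 0`, `ε > 0`,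
`t_pp′ε < t_pd²`), with a positive energy denominator. The upper end is attained iff the contour meets the axis inside the zone (electron-like surface). [folklore] -/
theorem dWeight_mem_Icc_node_axis {Δ tpd tpp c x y ε : ℝ} (hΔ : 0 ≤ Δ) (hc : 0 ≤ c) (hct : c ≤ tpp) (htpp : 0 < tpp) (htpd : tpd ≠ 0) (hε : 0 < ε)
    (hm : c * ε < tpd ^ 2) (hx : x ∈ Set.Icc (0 : ℝ) 1) (hy : y ∈ Set.Icc (0 : ℝ) 1) (hP : charCubic Δ tpd tpp c x y ε = 0) :
    0 < dcharCubic Δ tpd tpp c x y ε ∧ dWeight Δ tpd tpp c x y ε ∈ Set.Icc (dWeightNode Δ tpd tpp c ε) (dWeightAxis Δ tpd tpp c ε) := by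
  have hE : 0 < Δ + ε := by linarith
  have hN : 0 < fsN tpd tpp c ε := fsN_pos htpd hc hct htpp hε.le
  have hD : 0 < fsD Δ tpd c ε := fsD_pos hE hm
  have hN1 : fsN1 tpd tpp c ε ≠ 0 := (fsN1_pos hct hε.le htpd).ne'
  have hPn := charCubic_xNode (Δ := Δ) hN1
  have hPa := charCubic_xAxis (Δ := Δ) (tpp := tpp) (sub_pos.2 hm).ne'
  have hWn := dcharCubic_node_pos hΔ hc hct hε htpd
  have hWa := dcharCubic_axis_pos (tpp := tpp) hE hε hc hm
  have hlo := (sum_mem_Icc_xNode_yFace hN hD hε.le hN1 hx hy hP).1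
  have hhi : x + y ≤ xAxis Δ tpd c ε + 0 := by
    rw [add_zero, xAxis_eq_div hE.ne' (sub_pos.2 hm).ne']; exact sum_le_of_contour_face0 hN hD hx.1 hy.1 hP
  -- positivity of the energy denominator at (x, y) from the two ends (affine in s)
  have hWn' := hWn; have hWa' := hWa
  rw [dcharCubic_eq_affine hN.ne' hPn] at hWn'
  rw [dcharCubic_eq_affine hN.ne' hPa] at hWa'
  have hW : 0 < dcharCubic Δ tpd tpp c x y ε := by
    rw [dcharCubic_eq_affine hN.ne' hP]; exact affine_pos_of_ends hWn' hWa' ⟨hlo, hhi⟩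
  refine ⟨hW, ?_, ?_⟩
  · rcases eq_or_lt_of_le hlo with h | h
    · show dWeight Δ tpd tpp c (xNode Δ tpd tpp c ε) (xNode Δ tpd tpp c ε) ε ≤ _
      rw [dWeight_on_contour hN.ne' hPn hWn.ne', dWeight_on_contour hN.ne' hP hW.ne', h]
    · exact (dWeight_lt_of_sum_lt hE hc hct hε.le hN hm hPn hP hWn hW h).le
  · rcases eq_or_lt_of_le hhi with h | h
    · show _ ≤ dWeight Δ tpd tpp c (xAxis Δ tpd c ε) 0 ε
      rw [dWeight_on_contour hN.ne' hP hW.ne', dWeight_on_contour hN.ne' hPa hWa.ne', h]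
    · exact (dWeight_lt_of_sum_lt hE hc hct hε.le hN hm hP hPa hW hWa h).le

/-! ## §3 The axis lever -/

/-- Difference of the axis weight at two energies (closed forms): `w_axis(ε₁) − w_axis(ε₂) = t_pd²(ε₂ − ε₁)[t_pd²Δ − t_pp′(Δ(ε₁ + ε₂) + ε₁ε₂)]/(D₁D₂)`. [folklore] -/
theorem dWeightAxis_sub {Δ tpd tpp c ε₁ ε₂ : ℝ} (htpd : tpd ≠ 0) (hE1 : 0 < Δ + ε₁) (h1 : 0 < ε₁) (hm1 : c * ε₁ < tpd ^ 2) (hE2 : 0 < Δ + ε₂)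
    (h2 : 0 < ε₂) (hm2 : c * ε₂ < tpd ^ 2) :
    dWeightAxis Δ tpd tpp c ε₁ - dWeightAxis Δ tpd tpp c ε₂ =
      tpd ^ 2 * (ε₂ - ε₁) * (tpd ^ 2 * Δ - c * (Δ * (ε₁ + ε₂) + ε₁ * ε₂)) /
        ((tpd ^ 2 * (Δ + 2 * ε₁) - c * ε₁ ^ 2) * (tpd ^ 2 * (Δ + 2 * ε₂) - c * ε₂ ^ 2)) := by
  rw [dWeightAxis_eq hE1 h1 htpd hm1, dWeightAxis_eq hE2 h2 htpd hm2]
  have hD1 : tpd ^ 2 * (Δ + 2 * ε₁) - c * ε₁ ^ 2 ≠ 0 := by nlinarith [mul_pos h1 (sub_pos.2 hm1)]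
  have hD2 : tpd ^ 2 * (Δ + 2 * ε₂) - c * ε₂ ^ 2 ≠ 0 := by nlinarith [mul_pos h2 (sub_pos.2 hm2)]
  rw [div_sub_div _ _ hD1 hD2, div_eq_div_iff (mul_ne_zero hD1 hD2) (mul_ne_zero hD1 hD2)]
  ring

/-- **THE AXIS LEVER**: `Δ > 0`, `0 < ε₁ < ε₂`, `t_pp′ε₂ < t_pd²` and `t_pp′(Δ(ε₁ + ε₂) + ε₁ε₂) < t_pd²Δ` ⇒ `w_axis(ε₂) < w_axis(ε₁)`; the last hypothesis is also NECESSARY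
(`dWeightAxis_sub`): for `t_pp′ε²` large against `t_pd²Δ` the axis weight turns around. [folklore] -/
theorem dWeightAxis_strictAnti {Δ tpd tpp c ε₁ ε₂ : ℝ} (hΔ : 0 < Δ) (hc : 0 ≤ c) (htpd : tpd ≠ 0) (h1 : 0 < ε₁) (h12 : ε₁ < ε₂) (hm : c * ε₂ < tpd ^ 2)
    (hlev : c * (Δ * (ε₁ + ε₂) + ε₁ * ε₂) < tpd ^ 2 * Δ) : dWeightAxis Δ tpd tpp c ε₂ < dWeightAxis Δ tpd tpp c ε₁ := by
  have h2 : 0 < ε₂ := h1.trans h12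
  have hm1 : c * ε₁ < tpd ^ 2 := lt_of_le_of_lt (mul_le_mul_of_nonneg_left h12.le hc) hm
  have hsub := dWeightAxis_sub (tpp := tpp) htpd (by linarith : 0 < Δ + ε₁) h1 hm1 (by linarith : 0 < Δ + ε₂) h2 hm
  have ht : 0 < tpd ^ 2 := by positivity
  have hD1 : 0 < tpd ^ 2 * (Δ + 2 * ε₁) - c * ε₁ ^ 2 := by nlinarith [mul_pos h1 (sub_pos.2 hm1), mul_pos ht hΔ]
  have hD2 : 0 < tpd ^ 2 * (Δ + 2 * ε₂) - c * ε₂ ^ 2 := by nlinarith [mul_pos h2 (sub_pos.2 hm), mul_pos ht hΔ]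
  have hpos : 0 < tpd ^ 2 * (ε₂ - ε₁) * (tpd ^ 2 * Δ - c * (Δ * (ε₁ + ε₂) + ε₁ * ε₂)) /
      ((tpd ^ 2 * (Δ + 2 * ε₁) - c * ε₁ ^ 2) * (tpd ^ 2 * (Δ + 2 * ε₂) - c * ε₂ ^ 2)) := by
    apply div_pos _ (mul_pos hD1 hD2)
    exact mul_pos (mul_pos ht (sub_pos.2 h12)) (sub_pos.2 hlev)
  linarith

/-- The axis lever at `t_pp′ = 0` is unconditional: `w_axis(ε) = (Δ + ε)/(Δ + 2ε)` is strictly decreasing on `(0, ∞)` for `Δ > 0` (`t_pd ≠ 0`). [folklore] -/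
theorem dWeightAxis_strictAnti_pure {Δ tpd tpp ε₁ ε₂ : ℝ} (hΔ : 0 < Δ) (htpd : tpd ≠ 0) (h1 : 0 < ε₁) (h12 : ε₁ < ε₂) :
    dWeightAxis Δ tpd tpp 0 ε₂ < dWeightAxis Δ tpd tpp 0 ε₁ := by
  have ht : 0 < tpd ^ 2 := by positivity
  exact dWeightAxis_strictAnti hΔ le_rfl htpd h1 h12 (by simpa using ht) (by simpa using mul_pos ht hΔ)

/-! ## §4 The shell theorem without a face window -/

/-- **SHELL THEOREM THROUGH AND BELOW THE SADDLE**: regime (`Δ > 0`, `0 ≤ t_pp′ ≤ t_pp`, `t_pp > 0`, `t_pd ≠ 0`), `0 < ε₁ ≤ ε₂`, `t_pp′ε₂ < t_pd²`, and the axis-lever margin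
`t_pp′(2Δ + ε₂)ε₂ ≤ t_pd²Δ` ⇒ EVERY zone Bloch state of every contour at `ε ∈ [ε₁, ε₂]` has **`w_node(ε₂) ≤ w_d ≤ w_axis(ε₁)`**. [folklore] -/
theorem dWeight_shell_axis {Δ tpd tpp c ε₁ ε₂ ε x y : ℝ} (hΔ : 0 < Δ) (hc : 0 ≤ c) (hct : c ≤ tpp) (htpp : 0 < tpp) (htpd : tpd ≠ 0) (h1 : 0 < ε₁)
    (h12 : ε₁ ≤ ε₂) (hm : c * ε₂ < tpd ^ 2) (hlev : c * ((2 * Δ + ε₂) * ε₂) ≤ tpd ^ 2 * Δ)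
    (hε : ε ∈ Set.Icc ε₁ ε₂) (hx : x ∈ Set.Icc (0 : ℝ) 1) (hy : y ∈ Set.Icc (0 : ℝ) 1) (hP : charCubic Δ tpd tpp c x y ε = 0) :
    0 < dcharCubic Δ tpd tpp c x y ε ∧ dWeight Δ tpd tpp c x y ε ∈ Set.Icc (dWeightNode Δ tpd tpp c ε₂) (dWeightAxis Δ tpd tpp c ε₁) := by
  have hε0 : 0 < ε := lt_of_lt_of_le h1 hε.1
  have hmε : c * ε < tpd ^ 2 := lt_of_le_of_lt (mul_le_mul_of_nonneg_left hε.2 hc) hm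
  obtain ⟨hW, hwin⟩ := dWeight_mem_Icc_node_axis hΔ.le hc hct htpp htpd hε0 hmε hx hy hP
  refine ⟨hW, (dWeightNode_antitone hΔ hc hct htpd hε0 hε.2).trans hwin.1, hwin.2.trans ?_⟩
  rcases eq_or_lt_of_le hε.1 with h | h
  · rw [h]
  · apply le_of_lt
    apply dWeightAxis_strictAnti hΔ hc htpd h1 h hmε
    -- c(Δ(ε₁+ε) + ε₁ε) ≤ c((2Δ + ε₂)ε₂)·… strictly below t_pd²Δ unless c = 0
    have hb : Δ * (ε₁ + ε) + ε₁ * ε < (2 * Δ + ε₂) * ε₂ := by nlinarith [hε.1, hε.2, h]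
    rcases eq_or_lt_of_le hc with hc0 | hcpos
    · rw [← hc0, zero_mul]; have : 0 < tpd ^ 2 := by positivity
      positivity
    · nlinarith [mul_lt_mul_of_pos_left hb hcpos]

end Summit.Ventures.CertifiedManyBodySolver.Downfold.Emery
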